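/-
COR-CM (cell pub-hodgecm2, stage 2 of the Hodge ladder) — count-neutral KERNEL COMBINATORICS «field level of the quaternion-pair dispatch: EVERY Galois CM field
of degree 16 whose Galois group contains a quaternion pair with −1 = complex conjugation has EXACTLY φ₂(F) generating faces» (seat prover-pub-hodgecm2-b23-g54-0,
binder prover b23, gen 54; claim HOME/INBOX.md l.25095 — stem `CorCM/FaceQuaternionDoubling*`).  Theorems only; `Census/QuaternionDoublingOrderSixteen.lean` (this
seat), the field transfer and `galTOfAut` BY NAME; nothing asserted.  `Interfaces.lean` (C1), every E term, B01, `Transposition/*`, `PortJoin/*`, `D2Bridge/*` untouched.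
HONEST FRAMING: `HC_CM` is NOT proved, here or anywhere in the tree; this file produces no period and proves no face period for any field; §2 is CONDITIONAL on
the face periods exactly as the earlier sockets.
T5: n/a-class (hypothesis binders: `[F:ℚ] = 16` and automorphisms `i₀, j₀` with `i₀` of order 4, `i₀²` inducing complex conjugation, `j₀² = i₀²`, `j₀ i₀ j₀⁻¹ = i₀⁻¹`,
`j₀ ∉ ⟨i₀⟩` — inhabited by the Galois CM fields with group `Q₈ × ℤ/2`, Pauli, `SD₁₆`, `Q₁₆`; checker: self, 2026-08-26).
-/
import Summits.HodgeConjecture.CorCM.Census.QuaternionDoublingOrderSixteen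
import Summits.HodgeConjecture.CorCM.FaceGenerationTransfer
import Summits.HodgeConjecture.CorCM.FaceCensusOddSliceTransport
import HarnessLib

/-!
# Field level of the quaternion-pair dispatch: every Galois CM field of degree `16` with a quaternion pair

**`isLeast_card_faces_hgen_of_quaternion_pair`**: a Galois CM field `F` of degree `16` with automorphisms `i₀, j₀` such that `i₀` has order `4`, `i₀²` induces complex
conjugation (at one embedding, hence at all), `j₀² = i₀²`, `j₀ i₀ j₀⁻¹ = i₀⁻¹` and `j₀ ∉ ⟨i₀⟩` — i.e. `Gal(F/ℚ) ⊇ Q₈` with `−1` = complex conjugation: the groups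
`Q₈ × ℤ/2`, `Q₈ ∘ ℤ/4` (Pauli), `SD₁₆`, `Q₁₆` — has EXACTLY `φ₂(F)` generating faces (`Census/QuaternionDoublingOrderSixteen`: an element of order `8` ⟹ seat b23
gen 50ʼs two-group capstone, else the quaternion-doubling law of this lane).  §2: the CONDITIONAL Hodge-conjecture reading.  `HC_CM` is NOT proved.

## References
* [Pohlmann1968] H. Pohlmann, Algebraic cycles on abelian varieties of complex multiplication type, Ann. of Math. 88 (1968), Thm 1.
* [Shimura1998] G. Shimura, Abelian Varieties with Complex Multiplication and Modular Functions, §6.2 Thm. 3, §8.1.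
-/

noncomputable section

open CategoryTheory NumberField NumberField.ComplexEmbedding
open Literature.AlgebraicGeometry Literature.AlgebraicGeometry.Motives Literature.AlgebraicGeometry.HodgeTheory
open Literature.AlgebraicGeometry.ComplexMultiplication Literature.AlgebraicGeometry.Milne1999
open Literature.NumberTheory.Automorphic
open Literature.NumberTheory.Automorphic.PicardCM
open Summit.HodgeConjecture.CorCM.Domination

namespace Summit.HodgeConjecture.CorCM.FaceQuaternionDoubling

open Summit.HodgeConjecture.CorCM.Prior.AllgGroup.RfwfAllgGroup
open Summit.HodgeConjecture.CorCM.Census.BlockParity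
open Summit.HodgeConjecture.CorCM.Census.Coinvariant
open Summit.HodgeConjecture.CorCM.Census
open Summit.HodgeConjecture.CorCM.FaceCensus.OddSlice (galTOfAut galTOfAut_mul galTOfAut_conjAut)

section Field

variable {F : Type} [Field F] [NumberField F]

/-! ## §1 Exactly `φ₂(F)` generating faces -/

/-- **A QUATERNION PAIR IN THE GALOIS TRANSLATES of a degree-`16` Galois CM field ⟹ EXACTLY `φ₂(F)` GENERATING FACES.** [folklore] -/
theorem isLeast_card_faces_hgen_of_quaternion_pair_galT [IsCMField F] [IsGalois ℚ F] (hdeg : Module.finrank ℚ F = 16) (i j : GalT F)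
    (hord : orderOf i = 4) (hii : i * i = conjT) (hjj : j * j = conjT) (hji : j * i * j⁻¹ = i⁻¹) (hj : j ∉ Subgroup.zpowers i) (σ₀ : F →+* ℂ) :
    IsLeast {n : ℕ | ∃ 𝒮 : Finset (Face F), 𝒮.card = n ∧
      ∀ f : Face F, lefChar f.corner (fun _ => ({σ₀} : Finset (F →+* ℂ))) ∈ AddSubgroup.closure
        {a : Asym F | ∃ g ∈ (𝒮 : Set (Face F)), ∃ σ : F →+* ℂ, a = lefChar g.corner (fun _ => ({σ} : Finset (F →+* ℂ)))}}
      (fibreTwo (conjT : GalT F) conjT_mul_self) := by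
  have hcard : Nat.card (GalT F) = 16 := by rw [Nat.card_eq_fintype_card, FaceCensus.card_galT, hdeg]
  refine FaceTransfer.isLeast_card_faces_hgen_of_intrinsic _ ?_ (fun S₀ hS₀ hS => ?_) σ₀
  · obtain ⟨S, hS, hcard', hgen⟩ := (QuaternionDoubling.isLeast_card_gfaces_generate_fibreTwo_of_quaternion_pair hcard
      FaceBasis.conjT_comm i j hord hii hjj hji hj conjT_mul_self).1
    exact ⟨S, hS, hcard'.le, hgen⟩
  · exact fibreTwo_le_card conjT conjT_mul_self FaceBasis.conjT_comm S₀ (Submodule.span ℤ (pairSet conjT)) le_rfl hS₀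
      (fun y hy => hS (gfaceSet_subset_hodgeSpan conjT conjT_mul_self hy))

/-- **EVERY GALOIS CM FIELD OF DEGREE `16` WITH A QUATERNION PAIR OF AUTOMORPHISMS (`i₀²` = complex conjugation) HAS EXACTLY `φ₂(F)` GENERATING FACES**
— the groups `Q₈ × ℤ/2`, Pauli, `SD₁₆`, `Q₁₆`, classification-free. [folklore] -/
theorem isLeast_card_faces_hgen_of_quaternion_pair [IsCMField F] [IsGalois ℚ F] (hdeg : Module.finrank ℚ F = 16) (σ₀ : F →+* ℂ) (i₀ j₀ : F ≃ₐ[ℚ] F)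
    (hord : orderOf i₀ = 4) (hcσ : σ₀.comp ((i₀ * i₀ : F ≃ₐ[ℚ] F) : F →+* F) = conjugate σ₀) (hjj : j₀ * j₀ = i₀ * i₀)
    (hji : j₀ * i₀ * j₀⁻¹ = i₀⁻¹) (hj : j₀ ∉ Subgroup.zpowers i₀) :
    IsLeast {n : ℕ | ∃ 𝒮 : Finset (Face F), 𝒮.card = n ∧
      ∀ f : Face F, lefChar f.corner (fun _ => ({σ₀} : Finset (F →+* ℂ))) ∈ AddSubgroup.closure
        {a : Asym F | ∃ g ∈ (𝒮 : Set (Face F)), ∃ σ : F →+* ℂ, a = lefChar g.corner (fun _ => ({σ} : Finset (F →+* ℂ)))}}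
      (fibreTwo (conjT : GalT F) conjT_mul_self) := by
  set e : (F ≃ₐ[ℚ] F) ≃* GalT F := MulEquiv.mk' (galTOfAut σ₀) (galTOfAut_mul σ₀) with he
  have he_apply : ∀ y, e y = galTOfAut σ₀ y := fun y => rfl
  have hord' : orderOf (e i₀) = 4 := by rw [← hord]; exact orderOf_injective e.toMonoidHom e.injective i₀
  have hii' : e i₀ * e i₀ = conjT := by rw [← map_mul, he_apply]; exact galTOfAut_conjAut σ₀ hcσ
  have hjj' : e j₀ * e j₀ = conjT := by rw [← map_mul, hjj, map_mul, hii']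
  have hji' : e j₀ * e i₀ * (e j₀)⁻¹ = (e i₀)⁻¹ := by rw [← map_mul, ← map_inv, ← map_mul, hji, map_inv]
  have hj' : e j₀ ∉ Subgroup.zpowers (e i₀) := by
    intro h
    apply hj
    obtain ⟨k, hk⟩ := Subgroup.mem_zpowers_iff.mp h
    rw [← map_zpow, e.apply_eq_iff_eq] at hk
    exact Subgroup.mem_zpowers_iff.mpr ⟨k, hk⟩
  exact isLeast_card_faces_hgen_of_quaternion_pair_galT hdeg (e i₀) (e j₀) hord' hii' hjj' hji' hj' σ₀

end Field

/-! ## §2 The conditional Hodge-conjecture reading -/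

/-- **HC for the slice of a Galois CM field of degree `16` with a quaternion pair (`i² = j²` = complex conjugation), from `φ₂(K)` face periods**
(CONDITIONAL; `HC_CM` is NOT proved). [cite: Shimura1998, §6.2 Theorem 3 and §6.1 Corollary of Theorem 2 (pp. 41–43)] [cite: Pohlmann1968, Thm. 1]
[cite: Milne1999LefschetzClasses, Thm. 3.2 and Cor. 4.5] [cite: MumfordAV1970, §19 Thm. 1 and p. 169] -/
theorem hodgeConjectureFor_of_quaternion_pair_of_exists_facePeriod (K : CMField) [hGal : IsGalois ℚ K] (σ₀ : (K : Type) →+* ℂ)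
    (hdeg : Module.finrank ℚ K = 16) (i j : GalT K) (hord : orderOf i = 4) (hii : i * i = conjT) (hjj : j * j = conjT)
    (hji : j * i * j⁻¹ = i⁻¹) (hj : j ∉ Subgroup.zpowers i) :
    ∃ 𝒮 : Finset (Face K), 𝒮.card = fibreTwo (conjT : GalT K) conjT_mul_self ∧
      ((∀ f ∈ 𝒮, ∃ ι₁ : K →+* ℂ, f.Admissible ι₁ ∧ ∃ (V : HermSpace3 K ι₁) (σ : K →+* ℂ),
        (Model.picardCMUniverse exists_isReal_hodgeModel_holds hodgePQ_independent_of_hodgeModel_holds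
          BallQuotient.ballQuotientUniformised_holds cmAbelianVarietyRealised_holds).PeriodNV ι₁ V K f.psi σ) →
      ∀ {P B : AbelianVariety ℂ}, AbelianVariety.IsProductOf (fun B : AbelianVariety ℂ =>
        ∃ (E : Type) (_ : Field E) (_ : NumberField E) (_ : IsCMField E) (_ : E →+* (K : Type)) (Φ : CMType E)
          (ι : 𝓞 E →+* End B) (ϑ : E →+* Module.End ℂ (complexBetti B.X 1)),
          IsCMTypeRealisation Φ B ι ϑ) P →
      AVDominatedBy B P → HodgeConjectureFor B.dim B.X) := by
  obtain ⟨⟨𝒮, hcard, hgen⟩, -⟩ := isLeast_card_faces_hgen_of_quaternion_pair_galT (F := K) hdeg i j hord hii hjj hji hj σ₀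
  refine ⟨𝒮, hcard, fun h P B hP hB => ?_⟩
  have h6 : 6 ≤ Module.finrank ℚ K := by rw [hdeg]; omega
  exact hodgeConjectureFor_of_avDominatedBy_isProductOf_of_exists_facePeriod_on K h6 (𝒮 : Set (Face K)) σ₀ hgen
    (fun f hf => h f (Finset.mem_coe.mp hf)) hP hB

end Summit.HodgeConjecture.CorCM.FaceQuaternionDoubling
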